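import Mathlib
import Literature.Analysis.Fourier.ExpAbsKernelPlancherel
import Summits.NavierStokesRegularity.NavierStokesRegularity.Theorems.FilamentSkeletonRssClause13SmoothingKernelFourier

/-!
# Clause 13-J, brick B4-core: the PLANCHEREL FORM of the smoothing kernel's quadratic form,
# `∫∫ K_q(t−u) f(u) conj f(t) du dt = (1/2π) ∫ (2/q)(1 − 𝔖(z√q)) |∫ f(x)e^{izx}dx|² dz ≥ 0`

Route `FilamentSkeletonRss`, child 28296 `Clause13NearStraight` (and its A1L twin); design of record
`filament-plan/DESIGN-NOTE-28296-tenure-g22.md` §4–§5: the band virial and the slice estimates evaluate quadratic forms of the model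
self operator `c_M·J(I − k_q∗)` on the Fourier side.  This file is the model case of that passage for the SMOOTHING part `K_q∗`
(`K_q(s) = (2q − s²)(s²+q)^{-5/2}`, B2), following the tree's `Literature.Analysis.Fourier.ExpAbsKernelPlancherel` (the same argument for
`e^{−c|v|}`) line by line: Fourier inversion for the continuous integrable kernel with integrable transform (`fourier_smoothingKernel`,
p664709: `𝓕K_q(w) = (2/q)(1 − 𝔖(2πw√q))`, exponentially small by `one_sub_liaSym_le_exp`, p662338), then Fubini.

* `integrable_smoothingKernel`, `integrable_fourier_smoothingKernel`, `smoothingKernel_eq_integral` (inversion: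
  `K_q(v) = (1/2π)∫ (2/q)(1 − 𝔖(z√q)) e^{izv} dz`);
* `integral_integral_smoothingKernel_sub` (**the Plancherel form**, `f ∈ L¹`), `…_eq_ofReal`, and
  `spectral_integral_smoothingKernel_nonneg` (the quadratic form of `K_q` is `≥ 0`: `𝔖 ≤ 1`).

Typing-agnostic.  Lane ns-filament-19175-p1 g13; `--supports stmt-NavierStokesRegularity-28296 --as helper`.
HONEST FRAMING: harmonic analysis of an explicit kernel attached to a HYPOTHETICAL filament skeleton on the NEGATIVE side of a MODEL route;
nothing here bears on Navier–Stokes regularity or blow-up.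
-/

noncomputable section

open MeasureTheory Real Complex Filter
open scoped FourierTransform ComplexConjugate
open Summit.NavierStokesRegularity.NavierStokesRegularity.Theorems.AnalyticStripLiaSymbol (liaSym liaSym_neg liaSym_zero
  one_sub_liaSym_nonneg one_sub_liaSym_le_exp)

namespace Summit.NavierStokesRegularity.NavierStokesRegularity.Theorems.MatchedKernel
set_option linter.dupNamespace false

/-! ### Integrability of the kernel and of its transform -/

/-- `K_q ∈ L¹` (complex-valued). [folklore] -/
theorem integrable_smoothingKernel {q : ℝ} (hq : 0 < q) :
    Integrable (fun s : ℝ => (((2 * q - s ^ 2) * ((s ^ 2 + q) ^ (5 / 2 : ℝ))⁻¹ : ℝ) : ℂ)) := by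
  have h := integrable_smoothingKernel_mul hq continuous_const (φ := fun _ => (1:ℝ)) (fun _ => by simp)
  simp only [mul_one] at h
  exact h.ofReal

/-- The multiplier is bounded by an integrable exponential: `|(2/q)(1 − 𝔖(2πw√q))| ≤ (10/q)e^{−π√q|w|}`. [folklore] -/
theorem norm_multiplier_le {q : ℝ} (hq : 0 < q) (w : ℝ) :
    ‖(((2 / q * (1 - liaSym (2 * π * w * √q))) : ℝ) : ℂ)‖ ≤ 10 / q * Real.exp (-(π * √q * |w|)) := by
  rw [Complex.norm_real, Real.norm_eq_abs, abs_mul, abs_of_pos (by positivity : (0:ℝ) < 2 / q),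
    abs_of_nonneg (one_sub_liaSym_nonneg _)]
  have hsq : 0 < √q := Real.sqrt_pos.mpr hq
  rcases eq_or_ne w 0 with hw | hw
  · subst hw
    simp only [mul_zero, zero_mul, liaSym_zero, sub_zero, abs_zero, neg_zero, Real.exp_zero, mul_one]
    exact div_le_div_of_nonneg_right (by norm_num) hq.le
  · have hx : 0 < 2 * π * |w| * √q := by positivity
    have heven : liaSym (2 * π * w * √q) = liaSym (2 * π * |w| * √q) := by
      rcases le_or_gt 0 w with h | h
      · rw [abs_of_nonneg h]
      · rw [abs_of_neg h, show 2 * π * -w * √q = -(2 * π * w * √q) by ring, liaSym_neg]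
    rw [heven]
    have h := one_sub_liaSym_le_exp _ hx
    have hexp : Real.exp (-(2 * π * |w| * √q / 2)) = Real.exp (-(π * √q * |w|)) := by
      congr 1; ring
    rw [hexp] at h
    calc 2 / q * (1 - liaSym (2 * π * |w| * √q)) ≤ 2 / q * (5 * Real.exp (-(π * √q * |w|))) := by gcongr
      _ = 10 / q * Real.exp (-(π * √q * |w|)) := by ring

/-- `𝓕 K_q ∈ L¹`. [folklore] -/
theorem integrable_fourier_smoothingKernel {q : ℝ} (hq : 0 < q) :
    Integrable (𝓕 (fun s : ℝ => (((2 * q - s ^ 2) * ((s ^ 2 + q) ^ (5 / 2 : ℝ))⁻¹ : ℝ) : ℂ))) := by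
  have hcont : Continuous (𝓕 (fun s : ℝ => (((2 * q - s ^ 2) * ((s ^ 2 + q) ^ (5 / 2 : ℝ))⁻¹ : ℝ) : ℂ))) :=
    VectorFourier.fourierIntegral_continuous Real.continuous_fourierChar continuous_inner
      (integrable_smoothingKernel hq)
  have hdom : Integrable (fun w : ℝ => 10 / q * Real.exp (-(π * √q * |w|))) := by
    have h := (Literature.Analysis.Fourier.integrable_exp_neg_mul_abs (by positivity : 0 < π * √q)).norm
    refine (h.congr (Eventually.of_forall fun w => ?_)).const_mul (10 / q)
    simp only [Complex.norm_real, Real.norm_eq_abs, abs_of_pos (Real.exp_pos _)]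
  refine hdom.mono' hcont.aestronglyMeasurable (Eventually.of_forall fun w => ?_)
  rw [fourier_smoothingKernel hq]
  exact norm_multiplier_le hq w

/-- The multiplier `z ↦ (2/q)(1 − 𝔖(z√q))` (un-normalised frequency) is integrable. [folklore] -/
theorem integrable_multiplier {q : ℝ} (hq : 0 < q) :
    Integrable (fun z : ℝ => (((2 / q * (1 - liaSym (z * √q))) : ℝ) : ℂ)) := by
  have h := (integrable_fourier_smoothingKernel hq).comp_mul_left' (R := (2 * π)⁻¹) (by positivity)
  refine h.congr (Eventually.of_forall fun z => ?_)
  dsimp only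
  rw [fourier_smoothingKernel hq, show 2 * π * ((2 * π)⁻¹ * z) * √q = z * √q by field_simp]

/-! ### Fourier inversion for the kernel -/

/-- **Inversion.** `K_q(v) = (1/2π) ∫ (2/q)(1 − 𝔖(z√q)) e^{izv} dz`. [folklore] -/
theorem smoothingKernel_eq_integral {q : ℝ} (hq : 0 < q) (v : ℝ) :
    ((((2 * q - v ^ 2) * ((v ^ 2 + q) ^ (5 / 2 : ℝ))⁻¹ : ℝ)) : ℂ) =
      (1 / (2 * π) : ℝ) * ∫ z : ℝ, (((2 / q * (1 - liaSym (z * √q))) : ℝ) : ℂ) * cexp (I * z * v) := by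
  have hcont : Continuous (fun s : ℝ => (((2 * q - s ^ 2) * ((s ^ 2 + q) ^ (5 / 2 : ℝ))⁻¹ : ℝ) : ℂ)) :=
    Complex.continuous_ofReal.comp (continuous_smoothingKernel hq)
  have hinv := congrFun (hcont.fourierInv_fourier_eq (integrable_smoothingKernel hq)
    (integrable_fourier_smoothingKernel hq)) v
  rw [← hinv, Real.fourierInv_eq_fourier_neg, Real.fourier_real_eq_integral_exp_smul]
  simp_rw [fourier_smoothingKernel hq, smul_eq_mul]
  have h : ∀ z : ℝ, cexp (↑(-2 * π * z * -v) * I) * (((2 / q * (1 - liaSym (2 * π * z * √q))) : ℝ) : ℂ)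
      = (fun y : ℝ => (((2 / q * (1 - liaSym (y * √q))) : ℝ) : ℂ) * cexp (I * y * v)) ((2 * π) * z) := by
    intro z
    simp only [mul_comm (cexp _)]
    congr 2
    push_cast
    ring
  simp_rw [h]
  rw [MeasureTheory.Measure.integral_comp_mul_left
    (fun y : ℝ => (((2 / q * (1 - liaSym (y * √q))) : ℝ) : ℂ) * cexp (I * y * v)) (2 * π)]
  rw [Complex.real_smul, abs_of_pos (by positivity)]
  norm_num

/-! ### The quadratic form -/

/-- `conj ∘ f` is integrable when `f` is. [folklore] -/
private theorem integrable_conj_comp' {f : ℝ → ℂ} (hf : Integrable f) :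
    Integrable fun x : ℝ => conj (f x) :=
  hf.mono (Complex.continuous_conj.comp_aestronglyMeasurable hf.aestronglyMeasurable)
    (Eventually.of_forall fun x => by simp)

/-- `(t, u) ↦ f(u) conj f(t)` is integrable on `ℝ × ℝ`. [folklore] -/
private theorem integrable_prod_mul_conj' {f : ℝ → ℂ} (hf : Integrable f) :
    Integrable (fun p : ℝ × ℝ => f p.2 * conj (f p.1)) (volume.prod volume) := by
  simpa [mul_comm] using (integrable_conj_comp' hf).mul_prod hf

/-- `conj (e^{izt}) = e^{-izt}`. [folklore] -/
private theorem conj_cexp_I_mul_mul' (z t : ℝ) : conj (cexp (I * z * t)) = cexp (-(I * z * t)) := by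
  rw [← Complex.exp_conj, map_mul, map_mul, Complex.conj_I, Complex.conj_ofReal,
    Complex.conj_ofReal]
  ring_nf

/-- `∫ conj f(t) e^{-izt} dt = conj (∫ f(t) e^{izt} dt)`. [folklore] -/
private theorem integral_conj_mul_cexp_neg' (f : ℝ → ℂ) (z : ℝ) :
    ∫ t : ℝ, conj (f t) * cexp (-(I * z * t)) = conj (∫ t : ℝ, f t * cexp (I * z * t)) := by
  rw [← integral_conj]
  refine integral_congr_ae (Eventually.of_forall fun t => ?_)
  simp only [map_mul, conj_cexp_I_mul_mul']

/-- `∫_{ℝ×ℝ} e^{iz(u-t)} f(u) conj f(t) = |∫ f(x)e^{izx}dx|²`. [folklore] -/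
private theorem integral_prod_cexp_mul_mul_conj' (f : ℝ → ℂ) (z : ℝ) :
    ∫ p : ℝ × ℝ, cexp (I * z * ((p.2 - p.1 : ℝ) : ℂ)) * (f p.2 * conj (f p.1)) ∂(volume.prod volume)
      = ((‖∫ x : ℝ, f x * cexp (I * z * x)‖ ^ 2 : ℝ) : ℂ) := by
  have h : ∀ p : ℝ × ℝ, cexp (I * z * ((p.2 - p.1 : ℝ) : ℂ)) * (f p.2 * conj (f p.1)) =
      (conj (f p.1) * cexp (-(I * z * p.1))) * (f p.2 * cexp (I * z * p.2)) := by
    intro p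
    rw [show cexp (I * z * ((p.2 - p.1 : ℝ) : ℂ)) = cexp (-(I * z * p.1)) * cexp (I * z * p.2) by
      rw [← Complex.exp_add]; congr 1; push_cast; ring]
    ring
  simp_rw [h]
  rw [integral_prod_mul (fun t : ℝ => conj (f t) * cexp (-(I * z * t)))
    (fun u : ℝ => f u * cexp (I * z * u)), integral_conj_mul_cexp_neg', Complex.conj_mul']
  norm_cast

/-- Integrability of the triple integrand behind the Fubini step. [folklore] -/
private theorem integrable_multiplier_mul_cexp_mul {q : ℝ} (hq : 0 < q) {f : ℝ → ℂ} (hf : Integrable f) :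
    Integrable (fun r : (ℝ × ℝ) × ℝ =>
      (((2 / q * (1 - liaSym (r.2 * √q))) : ℝ) : ℂ) * cexp (I * r.2 * ((r.1.2 - r.1.1 : ℝ) : ℂ)) *
        (f r.1.2 * conj (f r.1.1))) ((volume.prod volume).prod volume) := by
  have hm := integrable_multiplier hq
  have hprod := (integrable_prod_mul_conj' hf).mul_prod hm
  have hphase : AEStronglyMeasurable
      (fun r : (ℝ × ℝ) × ℝ => cexp (I * r.2 * ((r.1.2 - r.1.1 : ℝ) : ℂ)))
      ((volume.prod volume).prod volume) := by
    refine (Continuous.aestronglyMeasurable ?_)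
    fun_prop
  refine (hprod.bdd_mul hphase (c := 1) (Eventually.of_forall fun r => ?_)).congr
    (Eventually.of_forall fun r => ?_)
  · rw [Complex.norm_exp]
    simp only [Complex.mul_re, Complex.I_re, Complex.ofReal_re, zero_mul, Complex.I_im,
      Complex.ofReal_im, mul_zero, sub_zero, Complex.mul_im, one_mul, Real.exp_le_one_iff]
    nlinarith [mul_self_nonneg (r.2 * (r.1.2 - r.1.1))]
  · simp only
    ring

/-- **Plancherel form of the smoothing kernel (product version).**  For an integrable `f : ℝ → ℂ`,
`∫_{ℝ×ℝ} K_q(t−u) f(u) conj f(t) d(t,u) = (1/2π) ∫ (2/q)(1 − 𝔖(z√q)) |∫ f(x)e^{izx}dx|² dz`. [folklore] -/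
theorem integral_prod_smoothingKernel_sub {q : ℝ} (hq : 0 < q) {f : ℝ → ℂ} (hf : Integrable f) :
    ∫ p : ℝ × ℝ, ((((2 * q - (p.1 - p.2) ^ 2) * (((p.1 - p.2) ^ 2 + q) ^ (5 / 2 : ℝ))⁻¹ : ℝ)) : ℂ) * f p.2 * conj (f p.1)
        ∂(volume.prod volume) =
      (1 / (2 * π) : ℝ) * ∫ z : ℝ,
        (((2 / q * (1 - liaSym (z * √q))) * ‖∫ x : ℝ, f x * cexp (I * z * x)‖ ^ 2 : ℝ) : ℂ) := by
  have hker : ∀ p : ℝ × ℝ, ((((2 * q - (p.1 - p.2) ^ 2) * (((p.1 - p.2) ^ 2 + q) ^ (5 / 2 : ℝ))⁻¹ : ℝ)) : ℂ)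
      * f p.2 * conj (f p.1) =
      ∫ z : ℝ, ((1 / (2 * π) : ℝ) : ℂ) * ((((2 / q * (1 - liaSym (z * √q))) : ℝ) : ℂ) *
        cexp (I * z * ((p.2 - p.1 : ℝ) : ℂ)) * (f p.2 * conj (f p.1))) := by
    intro p
    have hassoc : ∀ A B C D : ℂ, A * B * C * D = A * (B * (C * D)) := fun _ _ _ _ => by ring
    have hev : ((((2 * q - (p.1 - p.2) ^ 2) * (((p.1 - p.2) ^ 2 + q) ^ (5 / 2 : ℝ))⁻¹ : ℝ)) : ℂ)
        = ((((2 * q - (p.2 - p.1) ^ 2) * (((p.2 - p.1) ^ 2 + q) ^ (5 / 2 : ℝ))⁻¹ : ℝ)) : ℂ) := by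
      rw [show (p.1 - p.2) ^ 2 = (p.2 - p.1) ^ 2 by ring]
    rw [hev, smoothingKernel_eq_integral hq (p.2 - p.1), hassoc, ← integral_mul_const, ← integral_const_mul]
  simp_rw [hker]
  have hH := integrable_multiplier_mul_cexp_mul hq hf
  rw [integral_integral_swap ((hH.const_mul (((1 / (2 * π) : ℝ) : ℂ))).congr
    (Eventually.of_forall fun r => rfl))]
  have hinner : ∀ z : ℝ, ∫ p : ℝ × ℝ, ((1 / (2 * π) : ℝ) : ℂ) *
      ((((2 / q * (1 - liaSym (z * √q))) : ℝ) : ℂ) * cexp (I * z * ((p.2 - p.1 : ℝ) : ℂ)) *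
        (f p.2 * conj (f p.1))) ∂(volume.prod volume) =
      ((1 / (2 * π) : ℝ) : ℂ) *
        ((((2 / q * (1 - liaSym (z * √q))) * ‖∫ x : ℝ, f x * cexp (I * z * x)‖ ^ 2 : ℝ) : ℂ)) := by
    intro z
    have hfun : (fun p : ℝ × ℝ => ((1 / (2 * π) : ℝ) : ℂ) *
        ((((2 / q * (1 - liaSym (z * √q))) : ℝ) : ℂ) * cexp (I * z * ((p.2 - p.1 : ℝ) : ℂ)) *
          (f p.2 * conj (f p.1)))) =
        fun p : ℝ × ℝ => (((1 / (2 * π) : ℝ) : ℂ) * ((((2 / q * (1 - liaSym (z * √q))) : ℝ) : ℂ))) *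
          (cexp (I * z * ((p.2 - p.1 : ℝ) : ℂ)) * (f p.2 * conj (f p.1))) := by
      ext p
      ring
    rw [hfun, integral_const_mul, integral_prod_cexp_mul_mul_conj']
    push_cast
    ring
  simp_rw [hinner]
  rw [integral_const_mul]

/-- **Plancherel form of the smoothing kernel (iterated version).**
`∫_ℝ ∫_ℝ K_q(t−u) f(u) conj f(t) du dt = (1/2π) ∫ (2/q)(1 − 𝔖(z√q)) |∫ f(x)e^{izx}dx|² dz` for integrable `f`. [folklore] -/
theorem integral_integral_smoothingKernel_sub {q : ℝ} (hq : 0 < q) {f : ℝ → ℂ} (hf : Integrable f) :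
    ∫ t : ℝ, ∫ u : ℝ, ((((2 * q - (t - u) ^ 2) * (((t - u) ^ 2 + q) ^ (5 / 2 : ℝ))⁻¹ : ℝ)) : ℂ) * f u * conj (f t) =
      (1 / (2 * π) : ℝ) * ∫ z : ℝ,
        (((2 / q * (1 - liaSym (z * √q))) * ‖∫ x : ℝ, f x * cexp (I * z * x)‖ ^ 2 : ℝ) : ℂ) := by
  rw [← integral_prod_smoothingKernel_sub hq hf, integral_prod]
  have hphase : AEStronglyMeasurable (fun p : ℝ × ℝ =>
      ((((2 * q - (p.1 - p.2) ^ 2) * (((p.1 - p.2) ^ 2 + q) ^ (5 / 2 : ℝ))⁻¹ : ℝ)) : ℂ)) (volume.prod volume) := by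
    refine Continuous.aestronglyMeasurable ?_
    exact Complex.continuous_ofReal.comp ((continuous_smoothingKernel hq).comp (continuous_fst.sub continuous_snd))
  have hq32 : 0 < q ^ (3 / 2 : ℝ) := Real.rpow_pos_of_pos hq _
  refine ((integrable_prod_mul_conj' hf).bdd_mul hphase (c := 2 * (q ^ (3 / 2 : ℝ))⁻¹)
    (Eventually.of_forall fun p => ?_)).congr (Eventually.of_forall fun p => ?_)
  · rw [Complex.norm_real, Real.norm_eq_abs]
    refine (abs_smoothingKernel_le hq (p.1 - p.2)).trans ?_
    have hle : q ^ (3 / 2 : ℝ) ≤ ((p.1 - p.2) ^ 2 + q) ^ (3 / 2 : ℝ) :=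
      Real.rpow_le_rpow hq.le (by nlinarith [sq_nonneg (p.1 - p.2)]) (by norm_num)
    have := inv_anti₀ hq32 hle
    linarith
  · simp only
    ring

/-- The spectral integral as a real number inside `ℂ`. [folklore] -/
theorem integral_integral_smoothingKernel_sub_eq_ofReal {q : ℝ} (hq : 0 < q) {f : ℝ → ℂ} (hf : Integrable f) :
    ∫ t : ℝ, ∫ u : ℝ, ((((2 * q - (t - u) ^ 2) * (((t - u) ^ 2 + q) ^ (5 / 2 : ℝ))⁻¹ : ℝ)) : ℂ) * f u * conj (f t) =
      ((1 / (2 * π) * ∫ z : ℝ,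
        (2 / q * (1 - liaSym (z * √q))) * ‖∫ x : ℝ, f x * cexp (I * z * x)‖ ^ 2 : ℝ) : ℂ) := by
  rw [integral_integral_smoothingKernel_sub hq hf]
  push_cast
  congr 1
  rw [← integral_complex_ofReal]
  push_cast
  rfl

/-- **Positivity of the smoothing kernel's quadratic form**: the spectral integral
`(1/2π)∫ (2/q)(1 − 𝔖(z√q)) |f̂(z)|² dz` is `≥ 0` because `𝔖 ≤ 1` (`one_sub_liaSym_nonneg`). [folklore] -/
theorem spectral_integral_smoothingKernel_nonneg {q : ℝ} (hq : 0 < q) (f : ℝ → ℂ) :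
    0 ≤ 1 / (2 * π) * ∫ z : ℝ,
        (2 / q * (1 - liaSym (z * √q))) * ‖∫ x : ℝ, f x * cexp (I * z * x)‖ ^ 2 := by
  have : 0 ≤ ∫ z : ℝ, (2 / q * (1 - liaSym (z * √q))) * ‖∫ x : ℝ, f x * cexp (I * z * x)‖ ^ 2 :=
    integral_nonneg fun z => by
      have h1 : 0 ≤ 1 - liaSym (z * √q) := one_sub_liaSym_nonneg _
      positivity
  positivity

end Summit.NavierStokesRegularity.NavierStokesRegularity.Theorems.MatchedKernel
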